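import Summits.QuantumFields.YangMills.Theorems.AllWindowsColdBoxLineGaussToolkit
import Summits.QuantumFields.YangMills.Theorems.AllWindowsColdBoxTiltCubicCap
import Summits.QuantumFields.YangMills.Theorems.AllWindowsColdBoxTiltDominatorsMoments
import Summits.QuantumFields.YangMills.Theorems.AllWindowsColdBoxCappedExpMoment
import Summits.QuantumFields.YangMills.Theorems.AllWindowsColdBoxTiltMomentsThresholds
import HarnessLib

/-!
# LINE-17 «hypercontractive second-order tilt expansion» on crux `AllWindowsColdBox.BoxMidWindowsSU22` (stmt-QuantumFields-24003):
# the SECOND CLAUSE `∫ e^{4|W|} dν ≤ 4` of stub E `stub_tiltMoments`, assembled from the cubic-chaos input (STUB-PLAN-E §2 E(8))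

`TiltMoments θ` (`…AllWindowsColdBoxBoxMidWindowsSU22LineDefs`) asks, for every admissible chart density and eventually in `β`, for
(1) `(∫ W⁸ dν)^{1/4} ≤ K⌈β^θ⌉⁶/β` and (2) `∫ e^{4|W|} dν ≤ 4`, `W = centredTilt θ β J`, `ν = lineGauss θ β = γ[|E]`, `γ = gaussD`,
`E = lineEvent θ β`.  This file proves clause (2) from ONE hypothesis on the cubic part `V₃ = tiltCubicW ρ₂ H β` of the tilt — the
hypercontractive even-moment bound `∫ V₃^{2k} dγ ≤ (2k−1)^{3k}(K₁(2H+3)⁶/β)^k` (`k ≥ 1`) with all even powers integrable, i.e. the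
output of E(1)+E(3)+E(5) of STUB-PLAN-E (sibling files `…TiltCubicForm/Gram/Variance` of seat w5) — by assembling the tree pieces:

* on `E`: `|tiltWE − V₃ − Σ_e log J(a_e)| ≤ 560β·Σ_qΣ_legs‖a‖⁴ ≤ 13440β·Σ_e‖a_e‖⁴ =: X₂` (E(0) `abs_tiltWE_sub_tiltCubicW_sub_log_le` +
  the leg count `remainder_le_sum_norm_pow_four`), `|Σ log J(a_e)| ≤ 2C₂Σ_e‖a_e‖² =: X₃` (`abs_sum_log_le_sum_norm_sq_of_admissible`,
  needs `2η ≤ r₂`), hence `|W| ≤ |V₃| + X₂ + X₃ + c₀`, `c₀ = |∫ tiltWE dν| ≤ (10/9)(1/800 + 200s₁ + E X₂ + E X₃) ≤ 1/120`;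
* `CappedExpMoment.integral_cond_exp_mul_abs_le_of_three` (`λ = 4`) and three calls of
  `CappedExpMoment.setIntegral_exp_mul_abs_le_of_moments` (`λ = 12`; `m = 3, 4, 2`; caps `abs_tiltCubicW_le_of_ball`,
  `quartic/quadratic_dominator_le_of_ball`; moments: the hypothesis, `integral_sum_norm_unscaleTE_{pow_four,sq}_pow_le`, second moments
  `integral_sq_{quartic,quadratic}_dominator_le`), each capped moment `≤ 11/5` under the thresholds of `eventually_expClauseThresholds`
  (`Δ_i ≤ 1/100`, `2η ≤ min(1/4, r₂)`, means `≤ 1/400`, `β ≥ 10` so that `γ(E) ≥ 9/10` by `eventually_lineGauss_package`);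
* `CappedExpMoment.cond_bound_le_four` closes: `(γ.real E)⁻¹·e^{4c₀}·(B₁+B₂+B₃)/3 ≤ 4`.

Main theorem **`tiltMoments_exp_of_cubic`**.  No definition; standard axioms.  HONEST LABEL: one half of the OPEN registered stub E of
one critic-PASSed line on the R2ξ″ RECORD-rung crux 24003, conditional on the cubic-chaos input; no stub is proved by name, no crux,
rung or summit is proved; the Yang–Mills mass gap is NOT proved by this file.
-/

set_option autoImplicit false

noncomputable section

open MeasureTheory ProbabilityTheory Finset
open Literature.MathematicalPhysics.QuantumLattice
open Literature.MathematicalPhysics.QuantumFieldTheory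
open Literature.MathematicalPhysics.QuantumFieldTheory.LatticeMaxwell
open Summit.QuantumFields.YangMills.Theorems.WeakCouplingRates
open Summit.QuantumFields.YangMills.Theorems.ColdBoxAllGroups
open Summit.QuantumFields.YangMills.Theorems.FreeEnergyLogCoefficient

namespace Summit.QuantumFields.YangMills.Theorems.AllWindowsColdBoxBoxMidLine

open Summit.QuantumFields.YangMills.Theorems.AllWindowsColdBox.CappedExpMoment

/-- Elementary: `|x| ≤ 1/800 + 200x²`. -/
theorem abs_le_const_add_sq (x : ℝ) : |x| ≤ 1 / 800 + 200 * x ^ 2 := by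
  rcases le_or_gt 0 x with h | h
  · rw [abs_of_nonneg h]; nlinarith [sq_nonneg (x - 1 / 400)]
  · rw [abs_of_neg h]; nlinarith [sq_nonneg (x + 1 / 400)]

/-- `e^{1/30} ≤ 11/10`. -/
theorem exp_four_mul_le_of_le {c : ℝ} (hc0 : 0 ≤ c) (hc : c ≤ 1 / 120) : Real.exp (4 * c) ≤ 11 / 10 := by
  have h := Real.exp_bound_div_one_sub_of_interval (x := 4 * c) (by positivity) (by linarith)
  refine h.trans ?_
  rw [div_le_iff₀ (by linarith)]
  linarith

/-- **The SECOND CLAUSE of stub E `stub_tiltMoments` of LINE-17, from the cubic-chaos input alone.**  If the cubic part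
`V₃ = tiltCubicW ρ₂ H β` of the tilt satisfies the hypercontractive even-moment bound `∫ V₃^{2k} dγ ≤ (2k−1)^{3k}·(K₁(2H+3)⁶/β)^k`
(`k ≥ 1`) with all even powers integrable (E(1)+E(3)+E(5) of STUB-PLAN-E), then for every `0 < θ ≤ 1/16` and every admissible
chart density, eventually in `β`: `∫ e^{4|W|} dν ≤ 4` (`W = centredTilt θ β J`, `ν = lineGauss θ β`).  Assembly: on the event,
`|tiltWE − V₃ − Σ log J| ≤ 13440β·Σ‖a_e‖⁴ = X₂` (E(0) + leg count), `|Σ log J| ≤ 2C₂Σ‖a_e‖² = X₃`, hence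
`|W| ≤ |V₃| + X₂ + X₃ + c₀` with `c₀ = |∫ tiltWE dν| ≤ (10/9)(1/800 + 200s₁ + E X₂ + E X₃) ≤ 1/120`; then the three capped
exponential moments (`λ = 12`, `m = 3, 4, 2`) are `≤ 11/5` each by `CappedExpMoment.setIntegral_exp_mul_abs_le_of_moments` under
the thresholds of `eventually_expClauseThresholds`, and `cond_bound_le_four` closes. -/
theorem tiltMoments_exp_of_cubic
    (hV : ∃ K₁ : ℝ, 0 ≤ K₁ ∧ ∀ (H : ℕ) (β : ℝ), 1 ≤ H → 1 ≤ β →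
      (∀ k : ℕ, 1 ≤ k → ∫ t, tiltCubicW ρ₂ H β t ^ (2 * k) ∂(gaussD H (dimE ρ₂)) ≤
          (2 * k - 1 : ℝ) ^ (k * 3) * (K₁ * (2 * (H : ℝ) + 3) ^ 6 / β) ^ k) ∧
      (∀ k : ℕ, Integrable (fun t => tiltCubicW ρ₂ H β t ^ (2 * k)) (gaussD H (dimE ρ₂))))
    {θ : ℝ} (hθ : 0 < θ) (hθ16 : θ ≤ 1 / 16) {r₂ C₂ : ℝ} {J : EuclideanSpace ℝ (Fin (dimE ρ₂)) → ℝ}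
    (hJ : AdmissibleDensity r₂ C₂ J) :
    ∃ β₀ : ℝ, ∀ β : ℝ, β₀ ≤ β → ∫ t, Real.exp (4 * |centredTilt θ β J t|) ∂(lineGauss θ β) ≤ 4 := by
  haveI : SecondCountableTopology (Matrix (Fin 2) (Fin 2) ℂ) := inferInstanceAs (SecondCountableTopology (Fin 2 → Fin 2 → ℂ))
  haveI : SecondCountableTopology SU2 := inferInstance
  have hρc : Continuous ρ₂ := continuous_fundamentalRep (Fin 2)
  have hinj : Function.Injective ρ₂ := fundamentalRep_injective (Fin 2)
  obtain ⟨hr₂, hC₂, hJc, hJb, hJhalf⟩ := hJ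
  obtain ⟨K₁, hK₁, hVK⟩ := hV
  obtain ⟨β₁, hpack⟩ := eventually_lineGauss_package hθ hθ16 (k := 1) le_rfl
  obtain ⟨β₂, hthr⟩ := eventually_expClauseThresholds hθ hθ16 hr₂ hC₂.le hK₁
  refine ⟨max β₁ β₂, fun β hβ => ?_⟩
  obtain ⟨hβ1, hνP, hγS, hcompl, -, hhalf⟩ := hpack β ((le_max_left _ _).trans hβ)
  obtain ⟨hβ10, hR4, hRr, hΔ₁, hΔ₂, hΔ₃, hs₁, hEX₂, hEX₃⟩ := hthr β ((le_max_right _ _).trans hβ)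
  have hβ0 : 0 < β := by linarith
  have hHr : (1 : ℝ) ≤ (⌈β ^ θ⌉₊ : ℝ) := (one_le_ceil_rpow_and_le hβ1 hθ.le).1
  have hH : 1 ≤ ⌈β ^ θ⌉₊ := by exact_mod_cast hHr
  haveI : IsProbabilityMeasure (gaussD ⌈β ^ θ⌉₊ (dimE ρ₂)) := isProbabilityMeasure_gaussD _ _
  -- no `set` abbreviations: H = ⌈β^θ⌉₊, γ = gaussD H (dimE ρ₂), E = lineEvent θ β, R = 2·etaOf β H (epsOf θ)
  have hSm : MeasurableSet (lineEvent θ β) := measurableSet_lineEvent θ β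
  have hR0 : 0 ≤ 2 * etaOf β ⌈β ^ θ⌉₊ (epsOf θ) := by unfold etaOf; positivity
  have hES : ∀ t ∈ lineEvent θ β, ∀ e, ‖unscaleTE ⌈β ^ θ⌉₊ (dimE ρ₂) β t e‖ ≤ 2 * etaOf β ⌈β ^ θ⌉₊ (epsOf θ) :=
    fun t ht e => ht.2 e
  -- mass of the event `≥ 9/10`
  have hp : 9 / 10 ≤ (gaussD ⌈β ^ θ⌉₊ (dimE ρ₂)).real (lineEvent θ β) := by
    have h1 : (gaussD ⌈β ^ θ⌉₊ (dimE ρ₂)).real (lineEvent θ β)ᶜ ≤ 1 / 10 := by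
      refine hcompl.trans ?_
      rw [pow_one]; exact one_div_le_one_div_of_le (by norm_num) hβ10
    have := probReal_compl_eq_one_sub (μ := gaussD ⌈β ^ θ⌉₊ (dimE ρ₂)) hSm
    linarith
  have hp0 : 0 < (gaussD ⌈β ^ θ⌉₊ (dimE ρ₂)).real (lineEvent θ β) := by linarith
  -- the cubic input at this `H, β`
  obtain ⟨hmom₁, hint₁⟩ := hVK ⌈β ^ θ⌉₊ β hH hβ1
  -- measurability
  have hX₁m : Measurable (tiltCubicW ρ₂ ⌈β ^ θ⌉₊ β) := measurable_tiltCubicW ρ₂ β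
  have hX₂m : Measurable fun t : TSpaceD ⌈β ^ θ⌉₊ (dimE ρ₂) =>
      13440 * β * ∑ e : ColdFreeIdx ⌈β ^ θ⌉₊, ‖unscaleTE ⌈β ^ θ⌉₊ (dimE ρ₂) β t e‖ ^ 4 :=
    (measurable_sum_norm_unscaleTE_pow β 4).const_mul _
  have hX₃m : Measurable fun t : TSpaceD ⌈β ^ θ⌉₊ (dimE ρ₂) =>
      2 * C₂ * ∑ e : ColdFreeIdx ⌈β ^ θ⌉₊, ‖unscaleTE ⌈β ^ θ⌉₊ (dimE ρ₂) β t e‖ ^ 2 :=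
    (measurable_sum_norm_unscaleTE_pow β 2).const_mul _
  have hTm : Measurable (tiltWE ρ₂ ⌈β ^ θ⌉₊ J β) := measurable_tiltWE ρ₂ hρc hinj hJc.measurable β
  -- the pointwise decomposition on the event
  have hdec : ∀ t ∈ lineEvent θ β, |tiltWE ρ₂ ⌈β ^ θ⌉₊ J β t| ≤
      |tiltCubicW ρ₂ ⌈β ^ θ⌉₊ β t| + 13440 * β * ∑ e : ColdFreeIdx ⌈β ^ θ⌉₊, ‖unscaleTE ⌈β ^ θ⌉₊ (dimE ρ₂) β t e‖ ^ 4 +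
        2 * C₂ * ∑ e : ColdFreeIdx ⌈β ^ θ⌉₊, ‖unscaleTE ⌈β ^ θ⌉₊ (dimE ρ₂) β t e‖ ^ 2 := by
    intro t ht
    have h4 : ∀ e, ‖unscaleTE ⌈β ^ θ⌉₊ (dimE ρ₂) β t e‖ ≤ 1 / 4 := fun e => (hES t ht e).trans hR4
    have hr : ∀ e, ‖unscaleTE ⌈β ^ θ⌉₊ (dimE ρ₂) β t e‖ ≤ r₂ := fun e => (hES t ht e).trans hRr
    have h0 := abs_tiltWE_sub_tiltCubicW_sub_log_le ρ₂ hρc hβ0 J t h4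
    have hrem := remainder_le_sum_norm_pow_four hβ0.le t (plaquettesTouching (AxialGauge.boxEdges 4 (2 * ⌈β ^ θ⌉₊ + 1)))
    have hlog := abs_sum_log_le_sum_norm_sq_of_admissible ⟨hr₂, hC₂, hJc, hJb, hJhalf⟩ β t hr
    have htri : |tiltWE ρ₂ ⌈β ^ θ⌉₊ J β t| ≤
        |tiltWE ρ₂ ⌈β ^ θ⌉₊ J β t - tiltCubicW ρ₂ ⌈β ^ θ⌉₊ β t -
            ∑ e : ColdFreeIdx ⌈β ^ θ⌉₊, Real.log (J (unscaleTE ⌈β ^ θ⌉₊ (dimE ρ₂) β t e))| +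
          |tiltCubicW ρ₂ ⌈β ^ θ⌉₊ β t| + |∑ e : ColdFreeIdx ⌈β ^ θ⌉₊, Real.log (J (unscaleTE ⌈β ^ θ⌉₊ (dimE ρ₂) β t e))| := by
      have := abs_add_three (tiltWE ρ₂ ⌈β ^ θ⌉₊ J β t - tiltCubicW ρ₂ ⌈β ^ θ⌉₊ β t -
        ∑ e : ColdFreeIdx ⌈β ^ θ⌉₊, Real.log (J (unscaleTE ⌈β ^ θ⌉₊ (dimE ρ₂) β t e))) (tiltCubicW ρ₂ ⌈β ^ θ⌉₊ β t)
        (∑ e : ColdFreeIdx ⌈β ^ θ⌉₊, Real.log (J (unscaleTE ⌈β ^ θ⌉₊ (dimE ρ₂) β t e)))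
      rwa [show tiltWE ρ₂ ⌈β ^ θ⌉₊ J β t - tiltCubicW ρ₂ ⌈β ^ θ⌉₊ β t -
          ∑ e : ColdFreeIdx ⌈β ^ θ⌉₊, Real.log (J (unscaleTE ⌈β ^ θ⌉₊ (dimE ρ₂) β t e)) + tiltCubicW ρ₂ ⌈β ^ θ⌉₊ β t +
          ∑ e : ColdFreeIdx ⌈β ^ θ⌉₊, Real.log (J (unscaleTE ⌈β ^ θ⌉₊ (dimE ρ₂) β t e)) = tiltWE ρ₂ ⌈β ^ θ⌉₊ J β t by ring] at this
    linarith
  -- `|W| ≤ |X₁| + |X₂| + |X₃| + c₀` on the event, `c₀ = |∫ tiltWE dν|`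
  have hW : ∀ t ∈ lineEvent θ β, |centredTilt θ β J t| ≤ |tiltCubicW ρ₂ ⌈β ^ θ⌉₊ β t| +
      |13440 * β * ∑ e : ColdFreeIdx ⌈β ^ θ⌉₊, ‖unscaleTE ⌈β ^ θ⌉₊ (dimE ρ₂) β t e‖ ^ 4| +
      |2 * C₂ * ∑ e : ColdFreeIdx ⌈β ^ θ⌉₊, ‖unscaleTE ⌈β ^ θ⌉₊ (dimE ρ₂) β t e‖ ^ 2| +
      |∫ s, tiltWE ρ₂ ⌈β ^ θ⌉₊ J β s ∂(lineGauss θ β)| := by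
    intro t ht
    have h := hdec t ht
    have hW' : |centredTilt θ β J t| ≤ |tiltWE ρ₂ ⌈β ^ θ⌉₊ J β t| + |∫ s, tiltWE ρ₂ ⌈β ^ θ⌉₊ J β s ∂(lineGauss θ β)| := by
      unfold centredTilt; exact abs_sub _ _
    have h2 : 13440 * β * ∑ e : ColdFreeIdx ⌈β ^ θ⌉₊, ‖unscaleTE ⌈β ^ θ⌉₊ (dimE ρ₂) β t e‖ ^ 4 ≤
        |13440 * β * ∑ e : ColdFreeIdx ⌈β ^ θ⌉₊, ‖unscaleTE ⌈β ^ θ⌉₊ (dimE ρ₂) β t e‖ ^ 4| := le_abs_self _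
    have h3 : 2 * C₂ * ∑ e : ColdFreeIdx ⌈β ^ θ⌉₊, ‖unscaleTE ⌈β ^ θ⌉₊ (dimE ρ₂) β t e‖ ^ 2 ≤
        |2 * C₂ * ∑ e : ColdFreeIdx ⌈β ^ θ⌉₊, ‖unscaleTE ⌈β ^ θ⌉₊ (dimE ρ₂) β t e‖ ^ 2| := le_abs_self _
    linarith
  have hWm : AEStronglyMeasurable (centredTilt θ β J) (gaussD ⌈β ^ θ⌉₊ (dimE ρ₂)) := by
    have : centredTilt θ β J = fun t => tiltWE ρ₂ ⌈β ^ θ⌉₊ J β t - ∫ s, tiltWE ρ₂ ⌈β ^ θ⌉₊ J β s ∂(lineGauss θ β) := rfl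
    rw [this]
    exact (hTm.sub measurable_const).aestronglyMeasurable
  -- caps on the event
  have hM₁ : ∀ t ∈ lineEvent θ β, |tiltCubicW ρ₂ ⌈β ^ θ⌉₊ β t| ≤
      24 * (#(plaquettesTouching (AxialGauge.boxEdges 4 (2 * ⌈β ^ θ⌉₊ + 1))) : ℝ) * β * (2 * etaOf β ⌈β ^ θ⌉₊ (epsOf θ)) ^ 3 :=
    fun t ht => abs_tiltCubicW_le_of_ball ρ₂ hβ0.le hR0 t (hES t ht)
  have hM₂ : ∀ t ∈ lineEvent θ β, |13440 * β * ∑ e : ColdFreeIdx ⌈β ^ θ⌉₊, ‖unscaleTE ⌈β ^ θ⌉₊ (dimE ρ₂) β t e‖ ^ 4| ≤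
      13440 * β * ((Fintype.card (ColdFreeIdx ⌈β ^ θ⌉₊) : ℝ) * (2 * etaOf β ⌈β ^ θ⌉₊ (epsOf θ)) ^ 4) := by
    intro t ht
    have h0 : 0 ≤ 13440 * β * ∑ e : ColdFreeIdx ⌈β ^ θ⌉₊, ‖unscaleTE ⌈β ^ θ⌉₊ (dimE ρ₂) β t e‖ ^ 4 :=
      mul_nonneg (mul_nonneg (by norm_num) hβ0.le) (Finset.sum_nonneg fun e _ => pow_nonneg (norm_nonneg _) 4)
    rw [abs_of_nonneg h0]
    exact quartic_dominator_le_of_ball hβ0.le t (hES t ht)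
  have hM₃ : ∀ t ∈ lineEvent θ β, |2 * C₂ * ∑ e : ColdFreeIdx ⌈β ^ θ⌉₊, ‖unscaleTE ⌈β ^ θ⌉₊ (dimE ρ₂) β t e‖ ^ 2| ≤
      2 * C₂ * ((Fintype.card (ColdFreeIdx ⌈β ^ θ⌉₊) : ℝ) * (2 * etaOf β ⌈β ^ θ⌉₊ (epsOf θ)) ^ 2) := by
    intro t ht
    have h0 : 0 ≤ 2 * C₂ * ∑ e : ColdFreeIdx ⌈β ^ θ⌉₊, ‖unscaleTE ⌈β ^ θ⌉₊ (dimE ρ₂) β t e‖ ^ 2 :=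
      mul_nonneg (mul_nonneg (by norm_num) hC₂.le) (Finset.sum_nonneg fun e _ => pow_nonneg (norm_nonneg _) 2)
    rw [abs_of_nonneg h0]
    exact quadratic_dominator_le_of_ball hC₂.le t (hES t ht)
  have hNP0 : (0 : ℝ) ≤ (#(plaquettesTouching (AxialGauge.boxEdges 4 (2 * ⌈β ^ θ⌉₊ + 1))) : ℝ) := Nat.cast_nonneg _
  have hNE0 : (0 : ℝ) ≤ (Fintype.card (ColdFreeIdx ⌈β ^ θ⌉₊) : ℝ) := Nat.cast_nonneg _
  have hM₁0 : 0 ≤ 24 * (#(plaquettesTouching (AxialGauge.boxEdges 4 (2 * ⌈β ^ θ⌉₊ + 1))) : ℝ) * β *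
      (2 * etaOf β ⌈β ^ θ⌉₊ (epsOf θ)) ^ 3 :=
    mul_nonneg (mul_nonneg (mul_nonneg (by norm_num) hNP0) hβ0.le) (pow_nonneg hR0 3)
  have hM₂0 : 0 ≤ 13440 * β * ((Fintype.card (ColdFreeIdx ⌈β ^ θ⌉₊) : ℝ) * (2 * etaOf β ⌈β ^ θ⌉₊ (epsOf θ)) ^ 4) :=
    mul_nonneg (mul_nonneg (by norm_num) hβ0.le) (mul_nonneg hNE0 (pow_nonneg hR0 4))
  have hM₃0 : 0 ≤ 2 * C₂ * ((Fintype.card (ColdFreeIdx ⌈β ^ θ⌉₊) : ℝ) * (2 * etaOf β ⌈β ^ θ⌉₊ (epsOf θ)) ^ 2) :=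
    mul_nonneg (mul_nonneg (by norm_num) hC₂.le) (mul_nonneg hNE0 (pow_nonneg hR0 2))
  -- integrability of the capped exponentials on the event (bounded there)
  have hIexp : ∀ {X : TSpaceD ⌈β ^ θ⌉₊ (dimE ρ₂) → ℝ} {M : ℝ}, Measurable X → (∀ t ∈ lineEvent θ β, |X t| ≤ M) →
      IntegrableOn (fun t => Real.exp (3 * 4 * |X t|)) (lineEvent θ β) (gaussD ⌈β ^ θ⌉₊ (dimE ρ₂)) := by
    intro X M hXm hXM
    refine Measure.integrableOn_of_bounded (measure_ne_top _ _)
      (Real.continuous_exp.comp_aestronglyMeasurable ((continuous_const.mul continuous_abs).comp_aestronglyMeasurable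
        hXm.aestronglyMeasurable)) (M := Real.exp (3 * 4 * M)) ?_
    refine (ae_restrict_iff' hSm).2 (ae_of_all _ fun t ht => ?_)
    rw [Real.norm_eq_abs, abs_of_nonneg (Real.exp_pos _).le]
    exact Real.exp_le_exp.2 (by nlinarith [hXM t ht])
  -- the three capped exponential moments are `≤ 11/5`
  have h34 : (3 : ℝ) * 4 = 12 := by norm_num
  have hB₁ : ∫ t in lineEvent θ β, Real.exp (3 * 4 * |tiltCubicW ρ₂ ⌈β ^ θ⌉₊ β t|) ∂(gaussD ⌈β ^ θ⌉₊ (dimE ρ₂)) ≤ 11 / 5 := by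
    rw [h34]
    have hs0 : 0 ≤ K₁ * (2 * (⌈β ^ θ⌉₊ : ℝ) + 3) ^ 6 / β := by positivity
    have h := setIntegral_exp_mul_abs_le_of_moments (gaussD ⌈β ^ θ⌉₊ (dimE ρ₂)) hSm hX₁m.aestronglyMeasurable
      (lam := 12) (by norm_num) hs0 hM₁0 hM₁ (m := 3) (by norm_num) hint₁ hmom₁ (hΔ₁.trans (by norm_num))
    rw [probReal_univ] at h
    refine h.trans ?_
    linarith [hΔ₁]
  have hB₂ : ∫ t in lineEvent θ β, Real.exp (3 * 4 * |13440 * β * ∑ e : ColdFreeIdx ⌈β ^ θ⌉₊,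
      ‖unscaleTE ⌈β ^ θ⌉₊ (dimE ρ₂) β t e‖ ^ 4|) ∂(gaussD ⌈β ^ θ⌉₊ (dimE ρ₂)) ≤ 11 / 5 := by
    rw [h34]
    have hs0 : 0 ≤ ∫ t, (13440 * β * ∑ e : ColdFreeIdx ⌈β ^ θ⌉₊, ‖unscaleTE ⌈β ^ θ⌉₊ (dimE ρ₂) β t e‖ ^ 4) ^ 2
        ∂(gaussD ⌈β ^ θ⌉₊ (dimE ρ₂)) := integral_nonneg fun t => sq_nonneg _
    have hshat := integral_sq_quartic_dominator_le (D := dimE ρ₂) hH hβ0 (13440 * β)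
    -- `Δ` is monotone in `s`
    have hΔ : Real.exp 1 ^ 2 * 12 ^ 2 * (∫ t, (13440 * β * ∑ e : ColdFreeIdx ⌈β ^ θ⌉₊,
        ‖unscaleTE ⌈β ^ θ⌉₊ (dimE ρ₂) β t e‖ ^ 4) ^ 2 ∂(gaussD ⌈β ^ θ⌉₊ (dimE ρ₂))) *
        (12 * (13440 * β * ((Fintype.card (ColdFreeIdx ⌈β ^ θ⌉₊) : ℝ) * (2 * etaOf β ⌈β ^ θ⌉₊ (epsOf θ)) ^ 4)) + 4) ^ (4 - 2) ≤
        1 / 100 := by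
      have hA0 : 0 ≤ Real.exp 1 ^ 2 * (12 : ℝ) ^ 2 := by positivity
      have hP0 : 0 ≤ (12 * (13440 * β * ((Fintype.card (ColdFreeIdx ⌈β ^ θ⌉₊) : ℝ) * (2 * etaOf β ⌈β ^ θ⌉₊ (epsOf θ)) ^ 4)) + 4) ^
          (4 - 2) := pow_nonneg (by linarith) _
      exact le_trans (mul_le_mul_of_nonneg_right (mul_le_mul_of_nonneg_left hshat hA0) hP0) hΔ₂
    have h := setIntegral_exp_mul_abs_le_of_moments (gaussD ⌈β ^ θ⌉₊ (dimE ρ₂)) hSm hX₂m.aestronglyMeasurable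
      (lam := 12) (by norm_num) hs0 hM₂0 hM₂ (m := 4) (by norm_num)
      (fun k => integrable_sum_norm_unscaleTE_pow_four_pow hβ0.le (13440 * β) (2 * k))
      (fun k hk => integral_sum_norm_unscaleTE_pow_four_pow_le hβ0.le (13440 * β) k hk) (hΔ.trans (by norm_num))
    rw [probReal_univ] at h
    refine h.trans ?_
    linarith [hΔ]
  have hB₃ : ∫ t in lineEvent θ β, Real.exp (3 * 4 * |2 * C₂ * ∑ e : ColdFreeIdx ⌈β ^ θ⌉₊,
      ‖unscaleTE ⌈β ^ θ⌉₊ (dimE ρ₂) β t e‖ ^ 2|) ∂(gaussD ⌈β ^ θ⌉₊ (dimE ρ₂)) ≤ 11 / 5 := by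
    rw [h34]
    have hs0 : 0 ≤ ∫ t, (2 * C₂ * ∑ e : ColdFreeIdx ⌈β ^ θ⌉₊, ‖unscaleTE ⌈β ^ θ⌉₊ (dimE ρ₂) β t e‖ ^ 2) ^ 2
        ∂(gaussD ⌈β ^ θ⌉₊ (dimE ρ₂)) := integral_nonneg fun t => sq_nonneg _
    have hshat := integral_sq_quadratic_dominator_le (D := dimE ρ₂) hH hβ0 (2 * C₂)
    have hΔ : Real.exp 1 ^ 2 * 12 ^ 2 * (∫ t, (2 * C₂ * ∑ e : ColdFreeIdx ⌈β ^ θ⌉₊,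
        ‖unscaleTE ⌈β ^ θ⌉₊ (dimE ρ₂) β t e‖ ^ 2) ^ 2 ∂(gaussD ⌈β ^ θ⌉₊ (dimE ρ₂))) *
        (12 * (2 * C₂ * ((Fintype.card (ColdFreeIdx ⌈β ^ θ⌉₊) : ℝ) * (2 * etaOf β ⌈β ^ θ⌉₊ (epsOf θ)) ^ 2)) + 4) ^ (2 - 2) ≤
        1 / 100 := by
      have hA0 : 0 ≤ Real.exp 1 ^ 2 * (12 : ℝ) ^ 2 := by positivity
      have hP0 : 0 ≤ (12 * (2 * C₂ * ((Fintype.card (ColdFreeIdx ⌈β ^ θ⌉₊) : ℝ) * (2 * etaOf β ⌈β ^ θ⌉₊ (epsOf θ)) ^ 2)) + 4) ^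
          (2 - 2) := pow_nonneg (by linarith) _
      exact le_trans (mul_le_mul_of_nonneg_right (mul_le_mul_of_nonneg_left hshat hA0) hP0) hΔ₃
    have h := setIntegral_exp_mul_abs_le_of_moments (gaussD ⌈β ^ θ⌉₊ (dimE ρ₂)) hSm hX₃m.aestronglyMeasurable
      (lam := 12) (by norm_num) hs0 hM₃0 hM₃ (m := 2) (by norm_num)
      (fun k => integrable_sum_norm_unscaleTE_sq_pow hβ0.le (2 * C₂) (2 * k))
      (fun k hk => integral_sum_norm_unscaleTE_sq_pow_le hβ0.le (2 * C₂) k hk) (hΔ.trans (by norm_num))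
    rw [probReal_univ] at h
    refine h.trans ?_
    linarith [hΔ]
  -- the centring constant `c₀ = |∫ tiltWE dν| ≤ 1/120`
  have hc₀ : |∫ s, tiltWE ρ₂ ⌈β ^ θ⌉₊ J β s ∂(lineGauss θ β)| ≤ 1 / 120 := by
    -- the dominating integrable function `g = 1/800 + 200·X₁² + X₂ + X₃`
    have h1 : Integrable (fun t : TSpaceD ⌈β ^ θ⌉₊ (dimE ρ₂) => tiltCubicW ρ₂ ⌈β ^ θ⌉₊ β t ^ 2) (gaussD ⌈β ^ θ⌉₊ (dimE ρ₂)) := by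
      have h := hint₁ 1
      rw [mul_one] at h
      exact h
    have h2 : Integrable (fun t : TSpaceD ⌈β ^ θ⌉₊ (dimE ρ₂) =>
        13440 * β * ∑ e : ColdFreeIdx ⌈β ^ θ⌉₊, ‖unscaleTE ⌈β ^ θ⌉₊ (dimE ρ₂) β t e‖ ^ 4) (gaussD ⌈β ^ θ⌉₊ (dimE ρ₂)) := by
      have h := integrable_sum_norm_unscaleTE_pow_four_pow (H := ⌈β ^ θ⌉₊) (D := dimE ρ₂) hβ0.le (13440 * β) 1
      simp only [pow_one] at h
      exact h
    have h3 : Integrable (fun t : TSpaceD ⌈β ^ θ⌉₊ (dimE ρ₂) =>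
        2 * C₂ * ∑ e : ColdFreeIdx ⌈β ^ θ⌉₊, ‖unscaleTE ⌈β ^ θ⌉₊ (dimE ρ₂) β t e‖ ^ 2) (gaussD ⌈β ^ θ⌉₊ (dimE ρ₂)) := by
      have h := integrable_sum_norm_unscaleTE_sq_pow (H := ⌈β ^ θ⌉₊) (D := dimE ρ₂) hβ0.le (2 * C₂) 1
      simp only [pow_one] at h
      exact h
    have h0c : Integrable (fun _ : TSpaceD ⌈β ^ θ⌉₊ (dimE ρ₂) => (1 / 800 : ℝ)) (gaussD ⌈β ^ θ⌉₊ (dimE ρ₂)) := integrable_const _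
    have h01 := h0c.add (h1.const_mul 200)
    have h012 := h01.add h2
    have h0123 := h012.add h3
    have hgint : Integrable (fun t : TSpaceD ⌈β ^ θ⌉₊ (dimE ρ₂) => 1 / 800 + 200 * tiltCubicW ρ₂ ⌈β ^ θ⌉₊ β t ^ 2 +
        13440 * β * ∑ e : ColdFreeIdx ⌈β ^ θ⌉₊, ‖unscaleTE ⌈β ^ θ⌉₊ (dimE ρ₂) β t e‖ ^ 4 +
        2 * C₂ * ∑ e : ColdFreeIdx ⌈β ^ θ⌉₊, ‖unscaleTE ⌈β ^ θ⌉₊ (dimE ρ₂) β t e‖ ^ 2) (gaussD ⌈β ^ θ⌉₊ (dimE ρ₂)) := h0123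
    have hpt : ∀ t ∈ lineEvent θ β, |tiltWE ρ₂ ⌈β ^ θ⌉₊ J β t| ≤ 1 / 800 + 200 * tiltCubicW ρ₂ ⌈β ^ θ⌉₊ β t ^ 2 +
        13440 * β * ∑ e : ColdFreeIdx ⌈β ^ θ⌉₊, ‖unscaleTE ⌈β ^ θ⌉₊ (dimE ρ₂) β t e‖ ^ 4 +
        2 * C₂ * ∑ e : ColdFreeIdx ⌈β ^ θ⌉₊, ‖unscaleTE ⌈β ^ θ⌉₊ (dimE ρ₂) β t e‖ ^ 2 := by
      intro t ht
      have := hdec t ht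
      have := abs_le_const_add_sq (tiltCubicW ρ₂ ⌈β ^ θ⌉₊ β t)
      linarith
    have hTint : IntegrableOn (fun t => |tiltWE ρ₂ ⌈β ^ θ⌉₊ J β t|) (lineEvent θ β) (gaussD ⌈β ^ θ⌉₊ (dimE ρ₂)) := by
      refine Integrable.mono' hgint.integrableOn hTm.abs.aestronglyMeasurable ?_
      refine (ae_restrict_iff' hSm).2 (ae_of_all _ fun t ht => ?_)
      rw [Real.norm_eq_abs, abs_abs]
      exact hpt t ht
    have hg0 : ∀ t : TSpaceD ⌈β ^ θ⌉₊ (dimE ρ₂), 0 ≤ 1 / 800 + 200 * tiltCubicW ρ₂ ⌈β ^ θ⌉₊ β t ^ 2 +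
        13440 * β * ∑ e : ColdFreeIdx ⌈β ^ θ⌉₊, ‖unscaleTE ⌈β ^ θ⌉₊ (dimE ρ₂) β t e‖ ^ 4 +
        2 * C₂ * ∑ e : ColdFreeIdx ⌈β ^ θ⌉₊, ‖unscaleTE ⌈β ^ θ⌉₊ (dimE ρ₂) β t e‖ ^ 2 := fun t =>
      add_nonneg (add_nonneg (add_nonneg (by norm_num) (mul_nonneg (by norm_num) (sq_nonneg _)))
        (mul_nonneg (mul_nonneg (by norm_num) hβ0.le) (Finset.sum_nonneg fun e _ => pow_nonneg (norm_nonneg _) 4)))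
        (mul_nonneg (mul_nonneg (by norm_num) hC₂.le) (Finset.sum_nonneg fun e _ => pow_nonneg (norm_nonneg _) 2))
    -- `∫_E |T| dγ ≤ ∫ g dγ ≤ 3/400`
    have hEg : ∫ t in lineEvent θ β, |tiltWE ρ₂ ⌈β ^ θ⌉₊ J β t| ∂(gaussD ⌈β ^ θ⌉₊ (dimE ρ₂)) ≤ 3 / 400 := by
      refine (setIntegral_mono_on hTint hgint.integrableOn hSm hpt).trans ?_
      refine (setIntegral_le_integral hgint (ae_of_all _ hg0)).trans ?_
      have e1 := integral_add h012 h3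
      have e2 := integral_add h01 h2
      have e3 := integral_add h0c (h1.const_mul 200)
      simp only [Pi.add_apply] at e1 e2 e3
      rw [e1, e2, e3, integral_const, probReal_univ, one_smul, integral_const_mul, integral_const_mul, integral_const_mul]
      have hs : ∫ t, tiltCubicW ρ₂ ⌈β ^ θ⌉₊ β t ^ 2 ∂(gaussD ⌈β ^ θ⌉₊ (dimE ρ₂)) ≤ 1 / 320000 := by
        have h := hmom₁ 1 le_rfl
        simp only [mul_one, pow_one] at h
        norm_num at h
        exact h.trans hs₁
      have h4 := integral_sum_norm_unscaleTE_pow_four_le (D := dimE ρ₂) hH hβ0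
      have h2' := integral_sum_norm_unscaleTE_sq_le (D := dimE ρ₂) hH hβ0
      have e2 : 13440 * β * ∫ t, ∑ e : ColdFreeIdx ⌈β ^ θ⌉₊, ‖unscaleTE ⌈β ^ θ⌉₊ (dimE ρ₂) β t e‖ ^ 4 ∂(gaussD ⌈β ^ θ⌉₊ (dimE ρ₂))
          ≤ 1 / 400 := (mul_le_mul_of_nonneg_left h4 (mul_nonneg (by norm_num) hβ0.le)).trans hEX₂
      have e3 : 2 * C₂ * ∫ t, ∑ e : ColdFreeIdx ⌈β ^ θ⌉₊, ‖unscaleTE ⌈β ^ θ⌉₊ (dimE ρ₂) β t e‖ ^ 2 ∂(gaussD ⌈β ^ θ⌉₊ (dimE ρ₂))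
          ≤ 1 / 400 := (mul_le_mul_of_nonneg_left h2' (mul_nonneg (by norm_num) hC₂.le)).trans hEX₃
      linarith
    calc |∫ s, tiltWE ρ₂ ⌈β ^ θ⌉₊ J β s ∂(lineGauss θ β)| ≤ ∫ s, |tiltWE ρ₂ ⌈β ^ θ⌉₊ J β s| ∂(lineGauss θ β) :=
          abs_integral_le_integral_abs
      _ = ((gaussD ⌈β ^ θ⌉₊ (dimE ρ₂)).real (lineEvent θ β))⁻¹ *
            ∫ t in lineEvent θ β, |tiltWE ρ₂ ⌈β ^ θ⌉₊ J β t| ∂(gaussD ⌈β ^ θ⌉₊ (dimE ρ₂)) := by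
          unfold lineGauss
          rw [ProbabilityTheory.cond, integral_smul_measure, ENNReal.toReal_inv, smul_eq_mul, measureReal_def]
      _ ≤ (9 / 10)⁻¹ * (3 / 400) := by
          refine mul_le_mul ?_ hEg (integral_nonneg fun t => abs_nonneg _) (by norm_num)
          exact inv_anti₀ (by norm_num) hp
      _ = 1 / 120 := by norm_num
  -- assemble
  have hmain := integral_cond_exp_mul_abs_le_of_three (gaussD ⌈β ^ θ⌉₊ (dimE ρ₂)) hSm (lam := 4) (by norm_num) hW hWm
    (hIexp hX₁m hM₁) (hIexp hX₂m hM₂) (hIexp hX₃m hM₃)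
  unfold lineGauss
  refine hmain.trans ?_
  exact cond_bound_le_four hp (Real.exp_pos _).le (exp_four_mul_le_of_le (abs_nonneg _) hc₀) hB₁ hB₂ hB₃

end Summit.QuantumFields.YangMills.Theorems.AllWindowsColdBoxBoxMidLine

end
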